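import Literature.AnabelianGeometry.AbsoluteAnabelian.AbsAnabProp121viiSub
import Literature.NumberTheory.GaloisRepresentations.GaloisCohomologyProofs
import HarnessLib

/-!
# [AbsAnab] Prop 1.2.1 (vii), sub-DAG row L03 `KummerTwoOntoTorsion` — PROVED
# (`H²(G_K, μ_n) ⥲ Br(K)[n]`: step N1 of the printed proof at finite level)

S. Mochizuki, *The Absolute Anabelian Geometry of Hyperbolic Curves* (2004) [AbsAnab], §1.2,
Prop 1.2.1 (vii), printed proof p. 11: "the natural isomorphism
`H²(Kᵢ, μ_{ℚ/ℤ}(K̄ᵢ)) = H²(G_{Kᵢ}, μ_{ℚ/ℤ}(K̄ᵢ)) ⥲ H²(G_{Kᵢ}, K̄ᵢ^×)`" ([Serre2] §1.1: the Brauer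
group is torsion and `K̄^×/μ` is uniquely divisible).  At finite level `n` (row L03 of
`plan/L4/SUBDAG-AbsAnab-Prop121vii.md`, typed as `Prop121vii.KummerTwoOntoTorsion`): the map
`H²(G_K, μ_n(K̄)) → H²(G_K, K̄^×)` induced by `μ_n ↪ K̄^×` is injective and its image is exactly the
`n`-torsion.  Proof: the long exact sequence of the tree's Kummer sequence
`0 → μ_n → K̄^× →(n) K̄^× → 0` (`isSES_kummer`) — injectivity from Hilbert 90
`H¹(G_K, K̄^×) = 0` (`subsingleton_galoisCohomology_units_one_holds`) and
`IsSES.exists_δ₁_eq_of_map_two_eq_zero`; surjectivity onto `Br(K)[n]` from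
`IsSES.exists_map_two_eq_of_map_two_eq_zero`, `H²` of the `n`-th power map being multiplication by
`n` on explicit `2`-cocycles.  Valid for every field `K` (stated, as the row, for MLFs).
Proof-only (abc-iut seat w5-d198); nothing here bears on [IUTchIII] Cor. 3.12.
-/

noncomputable section

universe u

namespace Literature.AnabelianGeometry.AbsoluteAnabelian

namespace Prop121vii

open Field CategoryTheory ValuativeRel ContRepresentation
open Literature.NumberTheory.GaloisRepresentations
open Literature.NumberTheory.GaloisRepresentations.DiscreteGaloisModule

/-- `H²` of the `n`-th power map `K̄^× → K̄^×` is multiplication by `n` (on explicit `2`-cocycles).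
[cite: SerreGaloisCohomology1997, II §1.2] -/
theorem cohomologyMap_kummerπ_two (K : Type u) [Field K] (n : ℕ)
    (z : continuousCohomology 2 (units K).toTopRep) :
    cohomologyMap (kummerπ K n) 2 z = (n : ℤ) • z := by
  haveI : CompactSpace (absoluteGaloisGroup K) := absoluteGaloisGroup_compactSpace K
  obtain ⟨c, rfl⟩ := twoCocycleClass_surjective _ z
  have hc : contTwoCocycles.pullback (ContinuousMonoidHom.id (absoluteGaloisGroup K))
      (resIdHom (kummerπ K n)) c = (n : ℤ) • c :=
    Subtype.ext (ContinuousMap.ext fun p => by rw [pullback₂_id_resIdHom_apply, kummerπ_hom_apply]; rfl)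
  rw [cohomologyMap_twoCocycleClass, hc, twoCocycleClass_smul]
  exact Int.cast_smul_eq_zsmul ℤ (n : ℤ) _

/-- **Row L03 `KummerTwoOntoTorsion` — PROVED**: for an MLF `K` (indeed for any field) and `n ≥ 1`,
`H²(G_K, μ_n(K̄)) → H²(G_K, K̄^×)` is injective with image the `n`-torsion ([AbsAnab] p. 11, N1;
[Serre2] §1.1). [cite: MochizukiAbsAnab2004, Prop 1.2.1 (vii) p.11] -/
theorem kummerTwoOntoTorsion_holds : KummerTwoOntoTorsion.{u} := by
  intro K _ _ _ _ _ n _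
  haveI : CompactSpace (absoluteGaloisGroup K) := absoluteGaloisGroup_compactSpace K
  have h := isSES_kummer K n (NeZero.pos n)
  have h90 : Subsingleton (continuousCohomology 1 (units K).toTopRep) :=
    subsingleton_galoisCohomology_units_one_holds K
  refine ⟨(injective_iff_map_eq_zero _).2 fun z hz => ?_, fun z hz => ?_⟩
  · obtain ⟨x, rfl⟩ := h.exists_δ₁_eq_of_map_two_eq_zero z hz
    rw [Subsingleton.elim x 0, map_zero]
  · refine h.exists_map_two_eq_of_map_two_eq_zero z ?_
    rw [cohomologyMap_kummerπ_two, hz]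

end Prop121vii

end Literature.AnabelianGeometry.AbsoluteAnabelian
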